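import Summits.CriticalPhenomena.SAWScalingLimit.Theses.SAWImaginaryGeometry
import Summits.CriticalPhenomena.SAWScalingLimit.Theorems.SubseqIdentification.Negative.Necessity
import Literature.Probability.RandomPlanarGeometry.SpinObservableLimitPassage
import Literature.Probability.RandomPlanarGeometry.DrivingProcessWeakLimit

/-!
# Line `birth` — registered skeleton for the crux `IGMartingaleLimit` (stmt-CriticalPhenomena-5942)

Crux (FIXED; rank 2 of `route-CriticalPhenomena-SAWImaginaryGeometry`, decl
`Summit.CriticalPhenomena.SAWScalingLimit.Theses.SAWImaginaryGeometry.IGMartingaleLimit`): for every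
Dobrushin domain `(D; a, b)`, endpoint approximation, mesh sequence `s n → 0⁺`, probability weak limit `μ`
of the critical `δℤ²` SAW laws (pushed to curves), chordal uniformizer `φ : ℍ → D` and `μ`-a.e. Loewner
describability through `φ`, the time-limited κ = 8/3 IMAGINARY-GEOMETRY OBSERVABLE
`H_t(z) = arg(g_t(z) − W_t) + (1/3)·arg g_t′(z)` (`W = drivingFunction φ c`, `g_t = Loewner.map W t`,
`t` frozen at `T(z) = (Im z)²/9`) satisfies the cylinder identity
`∫ (H_{t'}(z) − H_{s'}(z))·ψ(W_{S_1}, …, W_{S_n}) dμ = 0` for all `z ∈ ℍ`, `s' ≤ t'`, `S_k ≤ s'`,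
continuous `|ψ| ≤ 1`.

## The cut — the route header's own TWO-LAYER PLAN ("IGMartingaleLimit ⇐ FlowLineMeanValue →
## WindingStatistic → DriverConvergence → IGMartingaleLimit, glue = the tree's proved passage pattern"),
## typed so that the glue IS the tree's PROVED discrete-martingale passage theorem

The crux has exactly the shape of the conclusion of
`Literature.Probability.RandomPlanarGeometry.Loewner.integral_cylinder_eq_zero_of_discreteMartingales`
(`ObservableDiscretePassage.lean`, PROVED: Doob optional sampling at every lattice scale + weak convergence
of the driving processes + a bounded JOINTLY CONTINUOUS path functional `N_u(w)`), read for the functional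
`N^z_u(w) = H_{u ∧ T(z)}(z)` (`igFunctional`).  Its inputs split into one analytic statement about the
continuum functional and one statement about the lattice model:

* S-A `stub_igFunctionalContinuous` — `IGFunctionalContinuous` (PROVABLE NOW, size L): for every bulk point
  `z ∈ ℍ`, `(u, w) ↦ N^z_u(w)` is jointly continuous on `[0, ∞) × C([0, ∞), ℝ)` (compact-open topology).
  The IG copy of the tree's `Loewner.continuous_base_min_cdhksTime` / `continuous_contSpinObservable_min_cdhksTime`
  (driver stability of `g_t(iy) − W_t` and of `g_t′(iy)` uniformly in `t ≤ T(iy)`, CDHKS §3 "equicontinuity of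
  `g^δ_t` and convergence of `G^δ_t`"), moved to a general bulk point by the horizontal translation
  `g^W_t(x + iy) = x + g^{W−x}_t(iy)`, composed with the CONTINUOUS branches of `arg`: in the short-time regime
  `t ≤ T(z)` one has `Im(g_t(z) − W_t) = Im g_t(z) ≥ (2/3)·Im z > 0` and `g_t′(z) = exp J`, `|Im J| ≤ ‖J‖ ≤ 1/2`
  (`Loewner.ShortTime`, `ShortTime.norm_exponent_le`), so neither `arg` meets its cut.
* S-B `stub_igLimitData` — `IGLimitData` (OPEN-PROBLEM grade, the HARDEST stub; = the route's layer-2 children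
  DriverConvergence ∧ (FlowLineMeanValue ∘ WindingStatistic) in passage-ready form): along any mesh sequence on
  which the SAW laws are probability measures converging weakly (pushed to curves) to a probability `μ`, and for
  any chordal uniformizer `φ` with `μ`-a.e. describability, there are continuous real processes `V n` on the
  LATTICE SAW spaces (intended: the half-plane-capacity driving process of the lattice walk read through discrete
  uniformizers `φ_n → φ`, Kemppainen–Smirnov 2017 Cor. 1.7 / CDHKS 2014 §3) with
  (J₀) `V n → drivingFunction φ` in distribution in `C([0, ∞), ℝ)` (`TendstoInDistribution`), and
  (D)  for every `z ∈ ℍ` and levels `s' < t' < T(z)` the DISCRETE IG-MARTINGALE DATA `IGDiscreteData` — verbatim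
       the hypothesis `hD` of the passage theorem: per scale a lattice filtration, a complex martingale `F`
       (intended: the Doob martingale `n ↦ E[X_γ(z_δ) | γ[0, n]]` of the slit-domain winding observable — a
       martingale by the EXACT domain Markov property of the two-point `x_c`-measure), stopping times
       `σ ≤ τ ≤ M` (first lattice steps of capacity `≥ s'`, `≥ t'`), stopped values a.e. bounded, and, off an
       event of vanishing mass, within `ε_n → 0` of `H_u(z)` of the discrete driver at times
       `u ∈ [s', s' + Δ_n]`, `[t', t' + Δ_n]` (FlowLineMeanValue: `E[X_γ(z) | γ[0,n]] ≈ X_{γ[0,n]}(z)`;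
       WindingStatistic: `X_{γ[0,n]}(z) ≈ H_{t_n}(z)`).
  `V` is existential on purpose: the tree has no discrete uniformizers yet, and the crux only ever sees the
  limit process `drivingFunction φ` — any lattice processes with (J₀) ∧ (D) do.

Composition `IGMartingaleLimit_of` (kernel-checked, no `sorry` of its own; hypotheses = the two stubs under
their registered names `__Registered.stub_…`, conclusion = the route decl BY NAME): (0) along the crux's
sequence the SAW laws are eventually probability measures (landed
`SubseqIdentification.Negative.eventually_isProbabilityMeasure_of_tendsto`: their mass is `0` or `1` and the
test integral of `f ≡ 1` converges to `1`) — shift the sequence; (1) S-B gives `V`, (J₀), (D); (2) S-A makes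
`igFunctional z` a bounded (`norm_igFunctional_le`: `|H| ≤ π + π/3 ≤ 6`) jointly continuous functional, so the
passage theorem yields the cylinder identity for `s' < t₁ < T(z)`; (3) `integral_cylinder_eq_zero_of_forall_lt_of_frozen`
(PROVED here: the abstract form of the tree's `integral_observableProcess_cylinder_eq_zero_of_forall_lt` — the
functional is frozen after `T(z)`, continuous in time, bounded; dominated convergence as `t ↑ T(z)`) extends it
to all `s' ≤ t'`; (4) the complex identity is the real one (`integral_complex_ofReal`).  The crux's `let H` is
`igProcess (fun u c ↦ drivingFunction φ c u) z` definitionally (`change`).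

Checks (2026-08-17, planner-skel-stmt-CriticalPhenomena-5942-0): `lean check --json` rc 0, errors [], sorries 2
= the two `stub_*` (lines of `stub_igFunctionalContinuous`, `stub_igLimitData`), zero elsewhere; audit:
`IGMartingaleLimit_of` "proves …SAWImaginaryGeometry.IGMartingaleLimit only under [hA : __Registered.stub_igFunctionalContinuous,
hB : __Registered.stub_igLimitData]".  BC3 probes (`bc/*_probe*.lean`, each
`first | exact? | simpa [S] | (unfold S; simpa) | aesop` and the tactics one by one): `IGFunctionalContinuous →
IGMartingaleLimit` FAIL (unsolved goal `⊢ IGMartingaleLimit`, aesop exhaustive search failed),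
`IGFunctionalContinuous → SAWScalingLimit` FAIL (unsolved goal `⊢ SAWScalingLimit`), `IGLimitData →
IGMartingaleLimit` FAIL, `IGLimitData → SAWScalingLimit` FAIL (per-tactic verdicts in `Lines/birth.md`).  No stub
is cheaply the crux or the summit: S-A is driver analysis with no lattice content; S-B never mentions `H` under
`μ` and reaches the crux only through optional sampling + weak convergence + the `T(z)`-extension.

Disproof used: none on file for this crux (`ledger crux ls`: no `Disproof.lean`, no Negative lemmas, no dead
lines) — nothing to honour yet.  Negatives index respected: the all-δ tightness `stmt-CriticalPhenomena-0772` is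
not used (S-B is stated along probability subsequences only, as the crux is).
-/

noncomputable section

open MeasureTheory Filter Topology Set Complex
open scoped NNReal ENNReal BoundedContinuousFunction
open UpperHalfPlane (upperHalfPlaneSet)
open Literature.Probability.RandomPlanarGeometry Literature.Probability.LatticeModels
open scoped Literature.Probability.RandomPlanarGeometry.PathBorel

namespace Summit.CriticalPhenomena.SAWScalingLimit.Cruxes.IGMartingaleLimit.Birth

/-! ### 1. Vocabulary: the κ = 8/3 imaginary-geometry observable and its time-limited process -/

/-- CDHKS's time horizon at the bulk point `z`: `T(z) = (Im z)²/9` (verbatim the crux's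
`(z.im ^ 2 / 9).toNNReal`; equals `Loewner.cdhksTime z.im`). Up to `T(z)` the point `z` is in the
short-time regime `Loewner.ShortTime` (`Im g_t(z) ≥ (2/3) Im z`, `|arg g_t′(z)| ≤ 1/2`). -/
def igTime (z : ℂ) : ℝ≥0 :=
  (z.im ^ 2 / 9).toNNReal

/-- **The κ = 8/3 imaginary-geometry observable** of a driving function `W` at time `t` and bulk
point `z`: `H_t(z) = arg(g_t(z) − W_t) + (1/3)·arg g_t′(z)` (`g_t = Loewner.map W t`) — the
harmonic-explorer martingale `arg(g_t − W_t)` (Schramm–Sheffield 2005) plus one third of the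
winding term `arg g_t′ = Im log g_t′` (Miller–Sheffield 2016, flow-line martingale `𝔥_t` with
`χ = 1/√6`, coefficient `(4 − κ)/4 = 1/3` at `κ = 8/3`). Verbatim the body of the crux's `let H`. -/
def igObservable (W : ℝ≥0 → ℝ) (t : ℝ≥0) (z : ℂ) : ℝ :=
  Complex.arg (Loewner.map W t z - (W t : ℂ)) +
    (1 / 3 : ℝ) * Complex.arg (deriv (Loewner.map W t) z)

/-- **The time-limited IG observable process** of a real process `W` on a sample space `Ω`:
`(u, ω) ↦ H_{u ∧ T(z)}(z)` for the path `W · ω` — so that the crux's `H c u z` is literally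
`igProcess (fun u c ↦ drivingFunction φ c u) z u c`. -/
def igProcess {Ω : Type*} (W : ℝ≥0 → Ω → ℝ) (z : ℂ) (u : ℝ≥0) (ω : Ω) : ℝ :=
  igObservable (fun r ↦ W r ω) (min u (igTime z)) z

/-- **The time-limited IG functional on driving-path space** `C([0, ∞), ℝ)` (locally uniform
topology), complex-valued as the tree's passage theorems want it:
`N^z_u(w) = H_{u ∧ T(z)}(z)` of the driver `w`. -/
def igFunctional (z : ℂ) (u : ℝ≥0) (w : C(ℝ≥0, ℝ)) : ℂ :=
  (igObservable w (min u (igTime z)) z : ℂ)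

/-- **Discrete IG-martingale data** at the capacity levels `s < t` for the bulk point `z`, along a
sequence of probability spaces `(Ω' k, P k)` carrying continuous-path processes `V k` — literally
the hypothesis `hD` of the tree's PROVED passage theorem
`Loewner.integral_cylinder_eq_zero_of_discreteMartingales` for the functional `igFunctional z`:
constants `C'` and null sequences `ε, Δ, η` such that every scale `k` carries a discrete filtration
`𝒢` (the lattice steps of the walk), a complex `𝒢`-martingale `F` (intended: the Doob martingale
`n ↦ E[X_γ(z_δ) | γ[0, n]]` of the slit-domain winding observable of the route's lattice engine
`FlowLineMeanValue`, stmt-CriticalPhenomena-6979), `𝒢`-stopping times `σ ≤ τ ≤ M` (first steps of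
capacity `≥ s`, `≥ t`) with `V k u`, `u ≤ s`, `𝒢_σ`-measurable, stopped values a.e. bounded by
`C'`, and, off an event `bad` of mass `≤ η k`, within `ε k` of the time-limited IG observable of
`V k` at some `u ∈ [s, s + Δ k]`, resp. `[t, t + Δ k]`. -/
def IGDiscreteData {Ω' : ℕ → Type*} [mΩ' : ∀ k, MeasurableSpace (Ω' k)]
    (P : ∀ k, Measure (Ω' k)) (V : ∀ k, ℝ≥0 → Ω' k → ℝ) (z : ℂ) (s t : ℝ≥0) : Prop :=
  ∃ (C' : ℝ) (ε Δ η : ℕ → ℝ≥0), Tendsto ε atTop (𝓝 0) ∧ Tendsto Δ atTop (𝓝 0) ∧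
    Tendsto η atTop (𝓝 0) ∧
    ∀ k, ∃ (𝒢 : Filtration ℕ (mΩ' k)) (F : ℕ → Ω' k → ℂ) (σ τ : Ω' k → WithTop ℕ)
      (hσ : IsStoppingTime 𝒢 σ) (M : ℕ) (bad : Set (Ω' k)),
      IsStoppingTime 𝒢 τ ∧ Martingale F 𝒢 (P k) ∧ σ ≤ τ ∧ (∀ ω, τ ω ≤ M) ∧
      (∀ u, u ≤ s → Measurable[hσ.measurableSpace] (V k u)) ∧
      (∀ᵐ ω ∂P k, ‖stoppedValue F σ ω‖ ≤ C') ∧ (∀ᵐ ω ∂P k, ‖stoppedValue F τ ω‖ ≤ C') ∧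
      MeasurableSet bad ∧ P k bad ≤ η k ∧
      ∀ᵐ ω ∂P k, ω ∉ bad →
        (∃ u ∈ Icc s (s + Δ k), ‖stoppedValue F σ ω - (igProcess (V k) z u ω : ℂ)‖ ≤ ε k) ∧
        (∃ u ∈ Icc t (t + Δ k), ‖stoppedValue F τ ω - (igProcess (V k) z u ω : ℂ)‖ ≤ ε k)

/-! ### 2. The two stub statements -/

/-- STUB A statement — **the time-limited IG functional is jointly continuous in (time, driver)**:
for every bulk point `z ∈ ℍ`, `(u, w) ↦ N^z_u(w) = arg(g_{u∧T}(z) − w_{u∧T}) + (1/3) arg g′_{u∧T}(z)`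
is continuous on `[0, ∞) × C([0, ∞), ℝ)`. The IG analogue of the tree's
`Loewner.continuous_contSpinObservable_min_cdhksTime` / `continuous_base_min_cdhksTime` (driver
stability of `g_t(iy) − W_t` and of `iy g_t′(iy)/(g_t(iy) − W_t)` uniformly in `t ≤ T(iy)`), plus
horizontal translation `g^W_t(x + iy) = x + g^{W − x}_t(iy)` and the continuous branches of `arg`
(`Im(g − W) > 0`; `g′ = exp J`, `|Im J| ≤ ‖J‖ ≤ 1/2`, `ShortTime.norm_exponent_le`). -/
def IGFunctionalContinuous : Prop :=
  ∀ z : ℂ, 0 < z.im → Continuous (Function.uncurry (igFunctional z))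

/-- STUB B statement — **the lattice limit data (J₀) ∧ (D) of the critical SAW for the IG
observable.** For every Dobrushin domain `(D; a, b)`, endpoint approximation, sequence of meshes
`s n → 0⁺` along which the critical SAW laws are probability measures and converge weakly (pushed
to curves) to a probability measure `μ`, and every chordal uniformizing map `φ` through which `μ`
is a.e. Loewner-describable, there are continuous real processes `V n` ON THE LATTICE SAW SPACES
`(DomainSAW Ω_{s n}, SAW.law)` (intended: the capacity driving function of the lattice walk read
through discrete uniformizing maps `φ_n → φ`, CDHKS §3 / KS Cor. 1.7–1.8) such that
(J₀) their path laws converge in distribution in `C([0, ∞), ℝ)` to the Loewner transform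
`drivingFunction φ` under `μ`, and (D) for every bulk point `z` and capacity levels
`s' < t' < T(z)` the discrete IG-martingale data `IGDiscreteData` hold (the route's lattice engine
`FlowLineMeanValue` — Doob martingale ≈ slit-domain winding observable — and `WindingStatistic` —
slit-domain winding observable ≈ `H_t(z)` of the discrete driver — in passage-ready form). -/
def IGLimitData : Prop :=
  ∀ (D : DobrushinDomain) (a b : ℝ → Site 2), SAW.IsEndpointApprox D a b →
    ∀ (s : ℕ → ℝ) (μ : Measure (CurveClass ℂ)) [IsProbabilityMeasure μ]
      [∀ n, IsProbabilityMeasure (SAW.law D.carrier (s n) (a (s n)) (b (s n)))],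
      Tendsto s atTop (𝓝[>] (0 : ℝ)) →
      (∀ f : CurveClass ℂ →ᵇ ℝ, Tendsto (fun n ↦ ∫ γ, f γ.curve
        ∂(SAW.law D.carrier (s n) (a (s n)) (b (s n)))) atTop (𝓝 (∫ x, f x ∂μ))) →
      ∀ (φ : ConformalEquiv upperHalfPlaneSet D.carrier), D.IsChordalUniformizing φ →
        (∀ᵐ c ∂μ, IsLoewnerDescribable φ c) →
        ∃ (V : ∀ n, ℝ≥0 → SAW.DomainSAW D.carrier (s n) (a (s n)) (b (s n)) → ℝ)
          (hVc : ∀ n γ, Continuous (V n · γ)),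
          TendstoInDistribution (fun n γ ↦ (⟨fun u ↦ V n u γ, hVc n γ⟩ : C(ℝ≥0, ℝ))) atTop
            (fun c ↦ (⟨fun u ↦ drivingFunction φ c u, continuous_drivingFunction φ c⟩ : C(ℝ≥0, ℝ)))
            (fun n ↦ SAW.law D.carrier (s n) (a (s n)) (b (s n))) μ ∧
          ∀ z : ℂ, 0 < z.im → ∀ s' t' : ℝ≥0, s' < t' → t' < igTime z →
            IGDiscreteData (fun n ↦ SAW.law D.carrier (s n) (a (s n)) (b (s n))) V z s' t'

/-! ### 3. The registered stubs (the only `sorry`s of the file) -/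

/-- **S-A `stub_igFunctionalContinuous`** — `IGFunctionalContinuous` (PROVABLE NOW, size L): joint continuity
of the time-limited IG functional in (time, driver).  Route: `Loewner.exists_norm_base_sub_base_le_of_le_cdhksTime`-type
driver stability for `g_t(z) − W_t` and `g_t′(z)` on `t ≤ T(z)` (translate `z = x + iy` to `iy`), time continuity
from the Loewner ODE, compact-open neighbourhoods contain sup-norm tubes on `[0, T(z)]`
(`ContinuousMap.tendsto_iff_forall_isCompact_tendstoUniformlyOn`), and `Complex.continuousAt_arg` off the
negative axis (`Im(g − W) > 0`; `Re g′ > 0` since `|arg g′| ≤ 1/2`). -/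
theorem stub_igFunctionalContinuous : IGFunctionalContinuous := by
  sorry

/-- **S-B `stub_igLimitData`** — `IGLimitData` (OPEN-PROBLEM grade, HARDEST): the lattice limit data
(J₀) driving-process convergence ∧ (D) discrete IG-martingale data of the critical SAW, for every probability
subsequential limit.  Intended engine: the route's FlowLineMeanValue (stmt-CriticalPhenomena-6979, lattice
flow-line mean-value identity for the edge-data slit Dirichlet extension with winding data, coefficient 1/3)
+ WindingStatistic (slit-domain winding observable → `H_t(z)` for sup-norm close curves) for (D), and
Kemppainen–Smirnov 2017 Thm 1.5 / Cor 1.7 (Condition G2 for the `x_c`-SAW in slit domains) for (J₀). -/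
theorem stub_igLimitData : IGLimitData := by
  sorry

/-! ### Name-keyed aliases of the two statements — the hypotheses of `IGMartingaleLimit_of`

The native skeleton audit (`#h21_check_skeleton`) admits a hypothesis of the skeleton theorem only if its
head constant is a registered obligation or is NAMED like a declared stub; `__Registered.stub_X` is the
statement of `stub_X` under that name (device of `Cruxes/AxiomsOfLimit/Lines/birth.lean`: the `__`
namespace is an implementation detail, so the audit's stub report resolves each `stub_…` to the sorried
theorem, not to the alias). Each alias is `rfl`-equal to its statement. -/
namespace __Registered

/-- Alias of `IGFunctionalContinuous` keyed by the registered stub name. -/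
abbrev stub_igFunctionalContinuous : Prop := IGFunctionalContinuous
/-- Alias of `IGLimitData` keyed by the registered stub name. -/
abbrev stub_igLimitData : Prop := IGLimitData

end __Registered

/-! ### 4. Sorry-free bookkeeping for the composition -/

/-- The IG functional is bounded: `|H| ≤ π + π/3 ≤ 6` (`|arg| ≤ π`). -/
theorem norm_igFunctional_le (z : ℂ) (u : ℝ≥0) (w : C(ℝ≥0, ℝ)) : ‖igFunctional z u w‖ ≤ 6 := by
  unfold igFunctional igObservable
  rw [Complex.norm_real, Real.norm_eq_abs]
  have h1 := Complex.abs_arg_le_pi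
    (Loewner.map (⇑w) (min u (igTime z)) z - ((w (min u (igTime z)) : ℝ) : ℂ))
  have h2 := Complex.abs_arg_le_pi (deriv (Loewner.map (⇑w) (min u (igTime z))) z)
  have hπ := Real.pi_le_four
  refine (abs_add_le _ _).trans ?_
  rw [abs_mul, abs_of_pos (by norm_num : (0 : ℝ) < 1 / 3)]
  nlinarith

/-- The IG functional is frozen after the time horizon `T(z)`. -/
theorem igFunctional_of_le {z : ℂ} {u : ℝ≥0} (hu : igTime z ≤ u) (w : C(ℝ≥0, ℝ)) :
    igFunctional z u w = igFunctional z (igTime z) w := by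
  simp only [igFunctional, min_eq_right hu, min_self]

/-- The time-limited IG process reads the path through the functional (definitional). -/
theorem igProcess_eq_igFunctional {Ω : Type*} (W : ℝ≥0 → Ω → ℝ) (hWc : ∀ ω, Continuous (W · ω))
    (z : ℂ) (u : ℝ≥0) (ω : Ω) :
    (igProcess W z u ω : ℂ) = igFunctional z u ⟨fun r ↦ W r ω, hWc ω⟩ := rfl

/-- **Extension of a cylinder identity past a freezing time** (abstract port of the tree's
`Loewner.integral_observableProcess_cylinder_eq_zero_of_forall_lt`): for a continuous-path process
`W` on `(Ω, μ)` with a.e.-measurable path map and a bounded, jointly continuous path functional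
`N_u(w)` frozen after the horizon `T` (`N_u = N_T` for `u ≥ T`), if
`E_μ[(N_t(W) − N_s(W)) ψ(W_S)] = 0` for all `s < t < T` then it holds for every `t ≥ s`
(continuity in time and dominated convergence as `t ↑ T`; the cases `t = s` and `s ≥ T` are
trivial). Used with `N = igFunctional z`, `T = igTime z` (stub A gives the continuity). -/
theorem integral_cylinder_eq_zero_of_forall_lt_of_frozen {Ω : Type*} {mΩ : MeasurableSpace Ω}
    {μ : Measure Ω} [IsProbabilityMeasure μ]
    {W : ℝ≥0 → Ω → ℝ} (hWc : ∀ ω, Continuous (W · ω))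
    (hWm : AEMeasurable (fun ω ↦ (⟨fun r ↦ W r ω, hWc ω⟩ : C(ℝ≥0, ℝ))) μ)
    {N : ℝ≥0 → C(ℝ≥0, ℝ) → ℂ} (hNc : Continuous (Function.uncurry N)) {C : ℝ}
    (hNC : ∀ u w, ‖N u w‖ ≤ C) {T : ℝ≥0} (hfreeze : ∀ u : ℝ≥0, T ≤ u → ∀ w, N u w = N T w)
    {s : ℝ≥0} {n : ℕ} (S : Fin n → ℝ≥0) {ψ : (Fin n → ℝ) → ℝ}
    (hψc : Continuous ψ) (hψ1 : ∀ v, |ψ v| ≤ 1)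
    (h : ∀ t : ℝ≥0, s < t → t < T →
      ∫ ω, (N t ⟨fun r ↦ W r ω, hWc ω⟩ - N s ⟨fun r ↦ W r ω, hWc ω⟩) *
        (ψ (fun i ↦ W (S i) ω) : ℂ) ∂μ = 0)
    {t : ℝ≥0} (hst : s ≤ t) :
    ∫ ω, (N t ⟨fun r ↦ W r ω, hWc ω⟩ - N s ⟨fun r ↦ W r ω, hWc ω⟩) *
      (ψ (fun i ↦ W (S i) ω) : ℂ) ∂μ = 0 := by
  have hC0 : 0 ≤ C := (norm_nonneg _).trans (hNC 0 0)
  have hevalc : Continuous fun w : C(ℝ≥0, ℝ) ↦ (fun i ↦ w (S i) : Fin n → ℝ) :=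
    continuous_pi fun i ↦ continuous_eval_const (S i)
  have hNt : ∀ u, Continuous fun w : C(ℝ≥0, ℝ) ↦ N u w := fun u ↦
    hNc.comp (continuous_const.prodMk continuous_id)
  have hNu : ∀ w, Continuous fun u : ℝ≥0 ↦ N u w := fun w ↦
    hNc.comp (continuous_id.prodMk continuous_const)
  rcases hst.eq_or_lt with rfl | hst'
  · simp
  rcases lt_or_ge t T with htT | htT
  · exact h t hst' htT
  rcases le_or_gt T s with hsT | hsT
  · have h0 : ∀ ω, N t ⟨fun r ↦ W r ω, hWc ω⟩ - N s ⟨fun r ↦ W r ω, hWc ω⟩ = 0 := fun ω ↦ by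
      rw [hfreeze t htT, hfreeze s hsT, sub_self]
    simp [h0]
  simp_rw [hfreeze t htT]
  -- approximate `T` from below by times `tm m ∈ (s, T)`
  obtain ⟨tm, -, htm_mem, htm_lim⟩ := exists_seq_strictMono_tendsto' hsT
  have hm : ∀ m, ∫ ω, (N (tm m) ⟨fun r ↦ W r ω, hWc ω⟩ - N s ⟨fun r ↦ W r ω, hWc ω⟩) *
      (ψ (fun i ↦ W (S i) ω) : ℂ) ∂μ = 0 :=
    fun m ↦ h (tm m) (htm_mem m).1 (htm_mem m).2
  have hψC : Continuous fun w : C(ℝ≥0, ℝ) ↦ (ψ (fun i ↦ w (S i)) : ℂ) :=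
    continuous_ofReal.comp (hψc.comp hevalc)
  have hmeas : ∀ u : ℝ≥0, AEStronglyMeasurable (fun ω ↦ (N u ⟨fun r ↦ W r ω, hWc ω⟩ -
      N s ⟨fun r ↦ W r ω, hWc ω⟩) * (ψ (fun i ↦ W (S i) ω) : ℂ)) μ := fun u ↦ by
    have hc : Continuous fun w : C(ℝ≥0, ℝ) ↦ (N u w - N s w) * (ψ (fun i ↦ w (S i)) : ℂ) :=
      ((hNt u).sub (hNt s)).mul hψC
    exact (hc.measurable.comp_aemeasurable hWm).aestronglyMeasurable
  have hbd : ∀ (u : ℝ≥0) ω, ‖(N u ⟨fun r ↦ W r ω, hWc ω⟩ - N s ⟨fun r ↦ W r ω, hWc ω⟩) *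
      (ψ (fun i ↦ W (S i) ω) : ℂ)‖ ≤ 2 * C := fun u ω ↦ by
    rw [norm_mul, Complex.norm_real, Real.norm_eq_abs]
    have hu4 := hNC u ⟨fun r ↦ W r ω, hWc ω⟩
    have hs4 := hNC s ⟨fun r ↦ W r ω, hWc ω⟩
    have h1 : ‖N u ⟨fun r ↦ W r ω, hWc ω⟩ - N s ⟨fun r ↦ W r ω, hWc ω⟩‖ ≤ 2 * C :=
      (norm_sub_le _ _).trans (by linarith)
    calc ‖N u ⟨fun r ↦ W r ω, hWc ω⟩ - N s ⟨fun r ↦ W r ω, hWc ω⟩‖ * |ψ fun i ↦ W (S i) ω|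
        ≤ 2 * C * 1 := mul_le_mul h1 (hψ1 _) (abs_nonneg _) (by linarith)
      _ = 2 * C := mul_one _
  have hlim : Tendsto (fun m ↦ ∫ ω, (N (tm m) ⟨fun r ↦ W r ω, hWc ω⟩ -
      N s ⟨fun r ↦ W r ω, hWc ω⟩) * (ψ (fun i ↦ W (S i) ω) : ℂ) ∂μ) atTop
      (𝓝 (∫ ω, (N T ⟨fun r ↦ W r ω, hWc ω⟩ - N s ⟨fun r ↦ W r ω, hWc ω⟩) *
        (ψ (fun i ↦ W (S i) ω) : ℂ) ∂μ)) := by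
    refine tendsto_integral_of_dominated_convergence (fun _ ↦ 2 * C) (fun m ↦ hmeas _)
      (integrable_const _) (fun m ↦ ae_of_all _ fun ω ↦ hbd _ ω) (ae_of_all _ fun ω ↦ ?_)
    exact ((((hNu _).tendsto _).comp htm_lim).sub tendsto_const_nhds).mul tendsto_const_nhds
  have h0 : Tendsto (fun m ↦ ∫ ω, (N (tm m) ⟨fun r ↦ W r ω, hWc ω⟩ -
      N s ⟨fun r ↦ W r ω, hWc ω⟩) * (ψ (fun i ↦ W (S i) ω) : ℂ) ∂μ) atTop (𝓝 0) := by
    simp_rw [hm]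
    exact tendsto_const_nhds
  exact tendsto_nhds_unique hlim h0

/-! ### 5. The composition (kernel-checked, no `sorry`) -/

open Summit.CriticalPhenomena.SAWScalingLimit.Theorems.SubseqIdentification.Negative
  (eventually_isProbabilityMeasure_of_tendsto) in
/-- **The two stubs imply the crux `IGMartingaleLimit` BY NAME.** Given the crux's data
`(D; a, b)`, `s n → 0⁺`, a probability weak limit `μ`, a chordal uniformizing map `φ` and a.e.
describability: (0) along the sequence the SAW laws are eventually probability measures (their mass
is `0` or `1` and the test integral of `f ≡ 1` converges to `1` — landed
`eventually_isProbabilityMeasure_of_tendsto`), so shift the sequence; (1) stub B gives lattice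
processes `V n` converging in distribution to the Loewner transform `W = drivingFunction φ` under
`μ` and the discrete IG-martingale data at all levels `s' < t₁ < T(z)`; (2) stub A makes the IG
functional a bounded jointly continuous path functional, so the tree's PROVED passage theorem
`Loewner.integral_cylinder_eq_zero_of_discreteMartingales` (Doob optional sampling at every scale +
weak convergence + oscillation control) yields the cylinder identity for `s' < t₁ < T(z)`;
(3) extension to all `s' ≤ t'` (`integral_cylinder_eq_zero_of_forall_lt_of_frozen`); (4) the
complex identity is the real one (`integral_complex_ofReal`). -/
theorem IGMartingaleLimit_of (hA : __Registered.stub_igFunctionalContinuous)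
    (hB : __Registered.stub_igLimitData) :
    Summit.CriticalPhenomena.SAWScalingLimit.Theses.SAWImaginaryGeometry.IGMartingaleLimit := by
  intro D a b hab s μ hs hμ hlim φ hφ hdesc H z hz s' t' hst n S hS ψ hψc hψb
  haveI := hμ
  -- the Loewner transform as a process on the curve space, and the crux's `H` through it
  set W : ℝ≥0 → CurveClass ℂ → ℝ := fun u c ↦ drivingFunction φ c u with hWdef
  have hWc : ∀ c, Continuous (W · c) := fun c ↦ continuous_drivingFunction φ c
  change ∫ c, (igProcess W z t' c - igProcess W z s' c) * ψ (fun k ↦ W (S k) c) ∂μ = 0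
  -- (0) the SAW laws are probability measures from some index on: shift the sequence
  obtain ⟨N₀, hN₀⟩ := Filter.eventually_atTop.1
    (eventually_isProbabilityMeasure_of_tendsto (Ω := D.carrier) (a := a) (b := b) (hlim 1))
  set s₁ : ℕ → ℝ := fun m ↦ s (m + N₀) with hs₁def
  haveI hP₁ : ∀ m, IsProbabilityMeasure (SAW.law D.carrier (s₁ m) (a (s₁ m)) (b (s₁ m))) :=
    fun m ↦ hN₀ _ (Nat.le_add_left N₀ m)
  have hs₁ : Tendsto s₁ atTop (𝓝[>] (0 : ℝ)) := hs.comp (tendsto_add_atTop_nat N₀)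
  have hlim₁ : ∀ f : CurveClass ℂ →ᵇ ℝ, Tendsto (fun m ↦ ∫ γ, f γ.curve
      ∂(SAW.law D.carrier (s₁ m) (a (s₁ m)) (b (s₁ m)))) atTop (𝓝 (∫ x, f x ∂μ)) :=
    fun f ↦ (hlim f).comp (tendsto_add_atTop_nat N₀)
  -- (1) lattice limit data [stub B]
  obtain ⟨V, hVc, hlaw, hD⟩ := hB D a b hab s₁ μ hs₁ hlim₁ φ hφ hdesc
  -- (2) joint continuity of the functional [stub A] and the passage theorem for `s' < t₁ < T(z)`
  have hNc : Continuous (Function.uncurry (igFunctional z)) := hA z hz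
  have hpass : ∀ t₁ : ℝ≥0, s' < t₁ → t₁ < igTime z →
      ∫ c, (igFunctional z t₁ ⟨fun r ↦ W r c, hWc c⟩ - igFunctional z s' ⟨fun r ↦ W r c, hWc c⟩) *
        (ψ (fun i ↦ W (S i) c) : ℂ) ∂μ = 0 := by
    intro t₁ hst₁ ht₁
    obtain ⟨C', ε, Δ, η, hε, hΔ, hη, hDk⟩ := hD z hz s' t₁ hst₁ ht₁
    have hobsV : ∀ k u ω, (igProcess (V k) z u ω : ℂ) =
        igFunctional z u ⟨fun r ↦ V k r ω, hVc k ω⟩ := fun k u ω ↦ rfl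
    simp only [hobsV] at hDk
    exact Loewner.integral_cylinder_eq_zero_of_discreteMartingales
      (P := fun m ↦ SAW.law D.carrier (s₁ m) (a (s₁ m)) (b (s₁ m))) hWc hVc hlaw hNc
      (norm_igFunctional_le z) s' t₁ hS hψc hψb hε hΔ hη hDk
  -- (3) all `s' ≤ t'` (the functional is frozen after `T(z)`, continuous in time, bounded)
  have hC := integral_cylinder_eq_zero_of_forall_lt_of_frozen hWc hlaw.aemeasurable_limit hNc
    (norm_igFunctional_le z) (T := igTime z) (fun u hu w ↦ igFunctional_of_le hu w) S hψc hψb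
    hpass hst
  -- (4) complex ⟹ real
  have hint : ∫ c, (((igProcess W z t' c - igProcess W z s' c) * ψ (fun k ↦ W (S k) c) : ℝ) : ℂ) ∂μ
      = ∫ c, (igFunctional z t' ⟨fun r ↦ W r c, hWc c⟩ - igFunctional z s' ⟨fun r ↦ W r c, hWc c⟩) *
          (ψ (fun i ↦ W (S i) c) : ℂ) ∂μ := by
    refine integral_congr_ae (ae_of_all _ fun c ↦ ?_)
    simp only [← igProcess_eq_igFunctional W hWc]
    push_cast
    ring
  rw [hC, integral_complex_ofReal] at hint
  exact_mod_cast hint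

/-- Wiring check: the registered stubs feed `IGMartingaleLimit_of` as stated. -/
example : Summit.CriticalPhenomena.SAWScalingLimit.Theses.SAWImaginaryGeometry.IGMartingaleLimit :=
  IGMartingaleLimit_of stub_igFunctionalContinuous stub_igLimitData

end Summit.CriticalPhenomena.SAWScalingLimit.Cruxes.IGMartingaleLimit.Birth

end
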